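import Summits.ResolutionOfSingularities.ResolutionOfSingularities.Theorems.MaxContactCutTightDefect
import Summits.ResolutionOfSingularities.ResolutionOfSingularities.Theorems.ItineraryCutClasses
import HarnessLib

/-!
# MaxContactCutItineraryCut — the decomp-res node «ItineraryCut» (lens-3 g10, CRITIC-LEDGER row 68 CLEARED AS
  DICHOTOMY NODE) wired BY NAME to the MaxContactCut items

Host route `MaxContactCut` (route-ResolutionOfSingularities-MaxContactCut); asides of this node: `ICNoPlateauDeep`
[UNDECIDED · IDEA-NEEDED · INSTRUMENTABLE T-plateau] and `ICNoRecurrentJumpDeep` [UNDECIDED · ATTACKABLE through the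
PROVED jump calculus · INSTRUMENTABLE T-jump-e2]; parent 31770 `DefectWalksDeep` (N51), above it 31769
`PolyPureTowersDeep`, 31768 `PolyPureTowersShallow`, 30253 `NoForcedTowers`.  Vocabulary:
`Theorems.ItineraryCutClasses` (itineraries, jump calculus, the two halves) over `Theorems.TightDefectClasses`.

Kernels (all PROVED, 0 sorry): asides ⟺ classes defs (`Iff.rfl`); EXACT 31770 ⟺ ICNoPlateauDeep ∧
ICNoRecurrentJumpDeep (`defectWalksDeep_iff_ic`); NECESSITY 30253 ⟹ both halves (mod `TowerRealisation`); the deep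
column 31769 ⟸ dictionary ∧ the two halves with the shade-0 walks DISCHARGED by the landed `strongWalksTerminate`;
the slice ⟸ 31768 ∧ dictionary ∧ halves, and its CP-discharged form; the jump half in its boundary form.  The root is
reached by the route's own `closes` (aside ladder; cone unchanged) — not restated here.

References: Hauser2010 §§F–G; Moh1987; CossartPiltant2019 Thm. 1.5 (i), p. 4.
-/

open Literature.AlgebraicGeometry.Resolution
open Summit.ResolutionOfSingularities.ResolutionOfSingularities.Theses
open Summit.ResolutionOfSingularities.ResolutionOfSingularities.Theorems.TightDefectClasses
open Summit.ResolutionOfSingularities.ResolutionOfSingularities.Theorems.TightDefectStrongWalks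
open Summit.ResolutionOfSingularities.ResolutionOfSingularities.Theorems.ItineraryCutClasses
open Summit.ResolutionOfSingularities.ResolutionOfSingularities.Theorems.MaxContactCutTightDefect

namespace Summit.ResolutionOfSingularities.ResolutionOfSingularities.Theorems.MaxContactCutItineraryCut

/-! ## The asides are the classes defs (definitional) -/

/-- Aside `ICNoPlateauDeep` ⟺ the plateau half. [folklore] -/
theorem icNoPlateauDeep_iff : MaxContactCut.ICNoPlateauDeep ↔ NoPlateauWalksDeep := Iff.rfl

/-- Aside `ICNoRecurrentJumpDeep` ⟺ the recurrent-jump half. [folklore] -/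
theorem icNoRecurrentJumpDeep_iff : MaxContactCut.ICNoRecurrentJumpDeep ↔ NoRecurrentJumpWalksDeep := Iff.rfl

/-! ## The EXACT cut of 31770 and the necessity ledger -/

/-- **EXACT (PROVED, order theory on `ℕ∞`): 31770 `DefectWalksDeep` ⟺ ICNoPlateauDeep ∧ ICNoRecurrentJumpDeep.**
[folklore] -/
theorem defectWalksDeep_iff_ic :
    MaxContactCut.DefectWalksDeep ↔ MaxContactCut.ICNoPlateauDeep ∧ MaxContactCut.ICNoRecurrentJumpDeep :=
  defectDeep_iff

/-- Both halves are WEAKER than 31770 (by letter). [folklore] -/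
theorem ic_of_defectWalksDeep (h : MaxContactCut.DefectWalksDeep) :
    MaxContactCut.ICNoPlateauDeep ∧ MaxContactCut.ICNoRecurrentJumpDeep :=
  defectDeep_iff.mp h

/-- 31770 from the two halves. [folklore] -/
theorem defectWalksDeep_of_ic (h₁ : MaxContactCut.ICNoPlateauDeep) (h₂ : MaxContactCut.ICNoRecurrentJumpDeep) :
    MaxContactCut.DefectWalksDeep :=
  deep_of_itinerary h₁ h₂

/-- **NECESSITY (modulo the realisation port): 30253 `NoForcedTowers` ⟹ both halves.** [folklore] -/
theorem ic_of_noForcedTowers (hR : TowerRealisation) (h : MaxContactCut.NoForcedTowers) :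
    MaxContactCut.ICNoPlateauDeep ∧ MaxContactCut.ICNoRecurrentJumpDeep :=
  ic_of_defectWalksDeep (pieces_of_noForcedTowers hR h).2.2.2.2.2

/-! ## The E-format columns from the two halves (shade-0 walks discharged by `strongWalksTerminate`) -/

/-- **Deep column aside 31769 ⟸ dictionary ∧ the two halves** (the lens kernel with `StrongWalksTerminate`
DISCHARGED by the landed theorem). [folklore] -/
theorem polyPureTowersDeep_of_ic (hT : TowerDictionary) (h₁ : MaxContactCut.ICNoPlateauDeep)
    (h₂ : MaxContactCut.ICNoRecurrentJumpDeep) : MaxContactCut.PolyPureTowersDeep :=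
  polyPureTowersTerminateDeep_of_itinerary hT strongWalksTerminate h₁ h₂

/-- **Slice ⟸ shallow aside 31768 ∧ dictionary ∧ the two halves.** [folklore] -/
theorem polyPureTowersTerminate_of_ic (h₀ : MaxContactCut.PolyPureTowersShallow) (hT : TowerDictionary)
    (h₁ : MaxContactCut.ICNoPlateauDeep) (h₂ : MaxContactCut.ICNoRecurrentJumpDeep) : PolyPureTowersTerminate :=
  polyPureTowersTerminate_of_collapse h₀ hT (defectWalksDeep_of_ic h₁ h₂)

/-- … with the CP column discharged through the valuative port (prover target #20). [folklore] -/
theorem polyPureTowersTerminate_of_ic_cp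
    (hCP : Literature.AlgebraicGeometry.Resolution.CossartPiltant2019LocalPermissible.{0}) (hV : ShallowColumnPort)
    (hT : TowerDictionary) (h₁ : MaxContactCut.ICNoPlateauDeep) (h₂ : MaxContactCut.ICNoRecurrentJumpDeep) :
    PolyPureTowersTerminate :=
  polyPureTowersTerminate_of_itinerary hCP hV hT strongWalksTerminate h₁ h₂

/-! ## The jump half in its boundary form (decided complement «no jump at r = 0» PROVED) -/

/-- **Aside `ICNoRecurrentJumpDeep` ⟺ its boundary reformulation** (`not_jump_of_boundaryFree`). [folklore] -/
theorem icNoRecurrentJumpDeep_iff_boundary :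
    MaxContactCut.ICNoRecurrentJumpDeep ↔ NoRecurrentBoundaryJumpWalksDeep :=
  noRecurrentJump_iff_boundary

end Summit.ResolutionOfSingularities.ResolutionOfSingularities.Theorems.MaxContactCutItineraryCut
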